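import Mathlib.Analysis.Normed.Operator.Compact.Basic
import Mathlib.Analysis.InnerProductSpace.Projection.Basic
import Mathlib.MeasureTheory.Function.L2Space
import Literature.Analysis.FluidPDE.SelfSimilarLiouville
import Literature.Analysis.FluidPDE.Vorticity
import HarnessLib

/-!
# Hyperbolic Type-I discretely self-similar orbits of Navier–Stokes (backward similarity variables)

Definition request `defn-IsHyperbolicTypeIDSSOrbit` of route `DssFarFieldSlaving`
(summit NavierStokesRegularity; cruxes `HyperbolicDssBridge`, `GaussianFloquetTheory`; idea card
`dss-far-field-slaving`, hypothesis (H2)). Physical space `ℝ³ = EuclideanSpace ℝ (Fin 3)`, `ν = 1`,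
putative blow-up point `(x₀, T) = (0, 0)`.

## Contents

* `lerayOrbit u` — the **backward similarity (Leray) variables** `U(s, y) = e^{-s/2} u(−e^{−s}, e^{−s/2} y)`,
  i.e. `u(x, t) = (−t)^{-1/2} U(x/√(−t), −log(−t))` (Giga–Kohn variables; Chae–Wolf 2017, §4;
  Bradshaw–Tsai 2017, §1 and §5), with the proved **twisted periodicity**
  `IsRotatedDSS.lerayOrbit_add_period`: a rotated `λ`-DSS field is `2 log λ`-periodic in `s` modulo
  conjugation by the isometry `R`; `lerayVorticity u s = curl (U s)`.
* `weightedMeasure w`, `divFreeL2 w` — the Hilbert space `X_w = {ω ∈ L²(ℝ³, w dy; ℝ³) : div ω = 0 weakly}`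
  realised as the orthogonal complement in `Lp ℝ³ 2 (w dy)` of the classes of `w⁻¹ ∇θ`, `θ ∈ C_c^∞`;
  `gaussianWeight y = e^{−|y|²/4}`.
* `IsLinearisedVorticitySolution U Ω a b ω` — continuous, slice-wise `L²`, weakly divergence-free weak
  solutions on `[a, b]` of the vorticity equation linearised at the orbit,
  `∂ₛω = (Δ − ½ y·∇ − 1) ω + curl (U × ω + BS[ω] × Ω)`, `BS` = Biot–Savart (`biotSavart` (accepted, `Vorticity`)).
* `IsLinearisedMonodromy w c R u M` — `M : X_w →L X_w` (extended by `0` on `X_wᗮ`) **propagates** every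
  such solution over one period: `M [ω(0)] = [π̃(R) ω(2 log c)]`, `π̃(R)` the pseudovector action.
  The monodromy is DATA; its existence for every Type-I DSS orbit is crux `GaussianFloquetTheory`
  and is not asserted here.
* `IsHyperbolicWithNeutral M N` — hyperbolicity of a bounded operator modulo a prescribed neutral
  subspace `N`, complexification-free: `E = X_s ⊕ X_u ⊕ N`, `X_s` closed exponentially stable,
  `X_u` finite-dimensional exponentially unstable, `M|N` power-bounded in both directions
  (= semisimple with spectrum on the unit circle).
* `IsTypeIDSSProfile c R u` — clause (a): `u` is an ancient mild solution (`ν = 1`) with measurable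
  slices, rotated `c`-DSS (`1 < c`), Type I, not a.e. trivial — a witness against
  `RotatedTypeIDSSLiouville c R` (`IsTypeIDSSProfile.not_rotatedTypeIDSSLiouville`) —, jointly
  smooth for `t < 0` (the hypothesis shape of crux `GaussianFloquetTheory`);
  `HasCompactLinearisedMonodromy w c R u` — some compact linearised monodromy exists (its conclusion
  shape).
* `IsHyperbolicTypeIDSSOrbitW w c R u` and the requested `IsHyperbolicTypeIDSSOrbit c R u`
  (`w = gaussianWeight`): (a) `IsTypeIDSSProfile c R u`, and (c) some compact linearised monodromy
  `M` on `X_w` is hyperbolic with neutral space spanned by the symmetry modes (orbit tangent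
  `∂ₛΩ(0)`, infinitesimal rotations); intended use:
  `HyperbolicDssBridge := (∃ c R u, IsHyperbolicTypeIDSSOrbit c R u) → …`,
  `GaussianFloquetTheory := ∀ c R u, IsTypeIDSSProfile c R u → HasCompactLinearisedMonodromy gaussianWeight c R u`.

## Design notes

* **Weight convention (fixed here).** `𝓛_ω = Δ − ½ y·∇ − 1` satisfies `div (γ ∇ω) = γ (Δ − ½ y·∇) ω`
  for `γ = e^{−|y|²/4}`, so it is symmetric with compact resolvent (Hermite spectrum `{−1 − k/2}`)
  on `L²(e^{−|y|²/4} dy)`: this is the card's `L²(γ)`, and `IsHyperbolicTypeIDSSOrbit` uses it. The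
  weight `e^{+|ξ|²/4}` of Gallay–Wayne (CMP 255 (2005), §4.1.3 and Lemma 4.7) belongs to the FORWARD
  variables `ξ = x/√t` and the operator `Δ + ½ ξ·∇ + 1`; in backward variables the drift `−½ y·∇`
  spreads Gaussians (`e^{−b|y|²} ↦ e^{−b(s)|y|²}`, `b' = −b(4b + 1)`), so `e^{s𝓛_ω}` does not act on
  `L²(e^{+|y|²/4})`. Every other weight is available through `IsHyperbolicTypeIDSSOrbitW w`
  (the route's fallback "polynomially weighted `L²`").
* **What is NOT asserted.** `L²(e^{−|y|²/4})` contains fields growing like `e^{|y|²/9}`, on which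
  Biot–Savart is undefined; whether the period map of the linearised equation (well defined on
  decaying data) extends to a bounded, let alone compact, operator on `X_w` is exactly crux
  `GaussianFloquetTheory` (route file: why-it-might-fail). Accordingly `M` is existentially
  quantified DATA constrained only by (i) boundedness/compactness on `X_w` and (ii) agreement with
  the linearised dynamics on the class `IsLinearisedVorticitySolution` (continuous in `(s, y)`,
  slices in `L²(dy)`, where every pairing below is an honest integral: `BS[ω(s)]` converges
  absolutely for continuous `L²` slices, the clause `integrable_kernel` records it). Classical
  solutions from `C_c^∞` divergence-free data belong to this class, so (ii) pins `M` down on (the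
  closure of) these data; no existence or uniqueness statement is smuggled in.
* **Weak form.** Pairing `∂ₛω = Δω − ½(y·∇)ω − ω + curl(U × ω) + curl(BS[ω] × Ω)` with a
  time-independent test field `φ ∈ C_c^∞(ℝ³; ℝ³)`:
  `d/ds ∫ ω·φ = ∫ ω·(Δφ + ½ (y·∇)φ + ½ φ) + ∫ (U × ω)·curl φ + ∫ (BS[ω] × Ω)·curl φ`
  (`(−½ y·∇)* = ½ y·∇ + 3/2`, `∫ curl F · φ = ∫ F · curl φ`), required as `HasDerivAt` on the open
  `s`-interval (no junk derivative); only `ω` itself enters, no derivative of `ω`.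
* **Monodromy modulo the isometry.** With `P = 2 log c`, `U(s + P) = R⁻¹ ∘ U(s) ∘ R`
  (`lerayOrbit_add_period`), hence `Ω(s + P) = π̃(R⁻¹) Ω(s)` with the pseudovector action
  `(π̃(Q) ω)(y) = det Q • Q ω(Q⁻¹ y)` (`pseudovectorPush`; `det Q = ±1`, relevant for improper `R`,
  which `RotatedTypeIDSSLiouville` allows). By `O(3)`-covariance the evolution family satisfies
  `S(s + P, s' + P) = π̃(R⁻¹) S(s, s') π̃(R)`, so `S(kP, 0) = π̃(R⁻¹)^k M^k` for the monodromy
  `M := π̃(R) ∘ S(P, 0)` ("`R_*⁻¹ ∘ S(s₀ + 2 log c, s₀)`" of the request, base point `s₀ = 0`, i.e.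
  `t = −1`; other base points give conjugate operators).
* **Neutral modes.** Continuous symmetries of the rescaled equation compatible with the DSS
  structure generate solutions of the linearised equation: scaling = `s`-translation gives the orbit
  tangent `∂ₛΩ` (multiplier `1`); rotations `Q = e^{θA}`, `A ∈ so(3)` (`skewAdjoint`), give
  `Z_A = AΩ − DΩ[A·]` (`rotationMode`), on whose span `M` acts by `A ↦ RAR⁻¹`: multiplier `1` for
  `A` commuting with `R` (the request's wording) and the remaining eigenvalues `e^{±iφ}` of `Ad_R`
  — also on the unit circle — for the others; all of them are therefore placed in the neutral space
  `N` (time and space translations give the unstable multipliers `e^{P}`, `e^{P/2}` and Galilean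
  boosts the stable `e^{−P/2}`; they are not neutral). "Semisimple" is rendered as two-sided power
  bounds on `N`, "finitely many multipliers in `|z| ≥ 1`" as `dim (X_u ⊕ N) < ∞`, "all other
  spectrum in `|z| < 1`" as exponential decay on the closed invariant complement `X_s` (equivalent
  to the spectral formulation by Riesz projections; Henry 1981, Ch. 7–8).
* **Regularity clause.** `smooth : ContDiffOn ℝ ∞ (uncurry u) ((−∞,0) × ℝ³)` makes `Ω = curl U`,
  `∂ₛΩ` and `Z_A` honest (no junk `fderiv`/`deriv`). For the objects of (a) it is automatic after
  passing to the continuous representative (bounded ancient mild solutions are smooth,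
  Koch–Nadirashvili–Seregin–Šverák 2009, §2–4), which is again rotated DSS and Type I.
* Not here: the evolution family itself, Floquet exponents, invariant manifolds (layer-2 items of
  the route), any claim that hyperbolic orbits exist.

## References

* D. Chae, J. Wolf, Comm. PDE 42 (2017) = arXiv:1610.09464, §4 (backward self-similar variables,
  DSS ⇔ `2 log λ`-periodicity of `U`) [ChaeWolf2017RemovingDSS].
* Z. Bradshaw, T.-P. Tsai, Comm. PDE 42 (2017) = arXiv:1610.05680, §1 (RDSS fields, (V-RDSS):
  periodicity modulo rotation in similarity variables), §5 (backward case, Open Problem 5.1)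
  [BradshawTsai2017CPDE].
* H. Jia, V. Šverák, JFA 268 (2015) = arXiv:1306.2136, §1–2 (forward analogue: linearisation
  `𝓛_σ` at a scale-invariant profile, relatively compact perturbation, finitely many eigenvalues to
  the right of the essential bound; Lemma 7 of the arXiv numbering) [JiaSverak2015].
* Th. Gallay, C. E. Wayne, Comm. Math. Phys. 255 (2005) = arXiv:math/0402449, §4.1.3 and Lemma 4.7
  (Gaussian space, `σ(𝓛) = {−n/2}`) [GallayWayne2005].
* D. Henry, *Geometric theory of semilinear parabolic equations*, LNM 840 (1981), Ch. 7–8 (period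
  map, characteristic multipliers, neighbourhood of a periodic orbit) [Henry1981].
* G. Koch, N. Nadirashvili, G. Seregin, V. Šverák, Acta Math. 203 (2009), §2–4 (regularity of
  bounded ancient mild solutions) [KochNadirashviliSereginSverak2009].
-/

noncomputable section

open MeasureTheory Set Function Filter Topology TopologicalSpace
open scoped NNReal ENNReal InnerProductSpace RealInnerProductSpace Laplacian

namespace Literature.Analysis.FluidPDE

/-- Local notation for physical space `ℝ³ = EuclideanSpace ℝ (Fin 3)`. -/
local notation "ℝ³" => EuclideanSpace ℝ (Fin 3)

/-! ### Backward similarity (Leray) variables about `(x₀, T) = (0, 0)` -/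

section Similarity

variable {E : Type*} [NormedAddCommGroup E] [NormedSpace ℝ E]
variable {F : Type*} [NormedAddCommGroup F] [NormedSpace ℝ F]

/-- The **backward similarity orbit** of a space–time field `u : ℝ → E → F` (time first) about the
space–time origin: `lerayOrbit u s y = e^{-s/2} • u (−e^{−s}) (e^{−s/2} • y)`, i.e.
`U(y, s) = √(−t) u(x, t)` with `y = x/√(−t)`, `s = −log(−t)` (Chae–Wolf 2017, §4, with
`(x_*, t_*) = (0, 0)`; Bradshaw–Tsai 2017, §5). Total in `s ∈ ℝ`; only the slices `u t`, `t < 0`,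
are read. [cite: ChaeWolf2017RemovingDSS, §4 (proof of Thm 1.5, self-similar transform)] -/
def lerayOrbit (u : ℝ → E → F) : ℝ → E → F :=
  fun s y => Real.exp (-s / 2) • u (-Real.exp (-s)) (Real.exp (-s / 2) • y)

/-- Unfolding `lerayOrbit`. [folklore] -/
@[simp]
theorem lerayOrbit_apply (u : ℝ → E → F) (s : ℝ) (y : E) :
    lerayOrbit u s y = Real.exp (-s / 2) • u (-Real.exp (-s)) (Real.exp (-s / 2) • y) :=
  rfl

/-- The orbit of the zero field is zero. [folklore] -/
@[simp]
theorem lerayOrbit_zero : lerayOrbit (0 : ℝ → E → F) = 0 := by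
  funext s y
  simp

/-- `e^{-s/2} · e^{-s/2} = e^{-s}`. [folklore] -/
theorem exp_neg_half_mul_self (s : ℝ) : Real.exp (-s / 2) * Real.exp (-s / 2) = Real.exp (-s) := by
  rw [← Real.exp_add]; congr 1; ring

/-- `√(e^{-s}) = e^{-s/2}`. [folklore] -/
theorem sqrt_exp_neg (s : ℝ) : Real.sqrt (Real.exp (-s)) = Real.exp (-s / 2) := by
  rw [← exp_neg_half_mul_self, Real.sqrt_mul_self (Real.exp_pos _).le]

/-- **Inversion of the similarity variables**: for `t < 0`,
`u t x = (√(−t))⁻¹ • lerayOrbit u (−log(−t)) ((√(−t))⁻¹ • x)` (Chae–Wolf 2017, §4: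
`u(x,t) = (t_* − t)^{-1/2} U(y, s)`). [cite: ChaeWolf2017RemovingDSS, §4 (proof of Thm 1.5, self-similar transform)] -/
theorem eq_lerayOrbit_of_neg (u : ℝ → E → F) {t : ℝ} (ht : t < 0) (x : E) :
    u t x = (Real.sqrt (-t))⁻¹ • lerayOrbit u (-Real.log (-t)) ((Real.sqrt (-t))⁻¹ • x) := by
  have hnt : 0 < -t := by linarith
  have hs : 0 < Real.sqrt (-t) := Real.sqrt_pos.2 hnt
  have h1 : Real.exp (-(-Real.log (-t))) = -t := by rw [neg_neg, Real.exp_log hnt]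
  have h2 : Real.exp (-(-Real.log (-t)) / 2) = Real.sqrt (-t) := by
    rw [← sqrt_exp_neg, h1]
  rw [lerayOrbit_apply, h1, h2, neg_neg, smul_smul, smul_smul, inv_mul_cancel₀ hs.ne', one_smul,
    mul_inv_cancel₀ hs.ne', one_smul]

/-- **Type I decay in similarity variables**: if `|u(t, x)| ≤ C₀/(|x| + √(−t))` on `t < 0` then the
orbit obeys `‖U(s, y)‖ ≤ C₀/(‖y‖ + 1)` for ALL `s` (Bradshaw–Tsai 2017, §5, Open Problem 5.1: the
bound is the scale-invariant one). In particular `|y| ‖U(s, y)‖ ≤ C₀`, the route's "key estimate". [cite: BradshawTsai2017CPDE, §5 Open Problem 5.1] -/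
theorem HasTypeIDecay.norm_lerayOrbit_le {C₀ : ℝ} {u : ℝ → E → F} (h : HasTypeIDecay C₀ u)
    (s : ℝ) (y : E) : ‖lerayOrbit u s y‖ ≤ C₀ / (‖y‖ + 1) := by
  have hpos : 0 < Real.exp (-s / 2) := Real.exp_pos _
  have key := h (-Real.exp (-s)) (by simpa using Real.exp_pos (-s)) (Real.exp (-s / 2) • y)
  rw [neg_neg, sqrt_exp_neg, norm_smul, Real.norm_of_nonneg hpos.le, ← mul_add_one,
    mul_comm (Real.exp (-s / 2)) (‖y‖ + 1), ← div_div] at key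
  rw [lerayOrbit_apply, norm_smul, Real.norm_of_nonneg hpos.le]
  have hden : 0 < ‖y‖ + 1 := by positivity
  calc Real.exp (-s / 2) * ‖u (-Real.exp (-s)) (Real.exp (-s / 2) • y)‖
      ≤ Real.exp (-s / 2) * (C₀ / (‖y‖ + 1) / Real.exp (-s / 2)) := by gcongr
    _ = C₀ / (‖y‖ + 1) := by field_simp

/-- **Twisted periodicity of rotated DSS orbits** (Bradshaw–Tsai 2017, §1, (V-RDSS): "an RDSS
solution … corresponds to a solution of (Leray) satisfying `V(z, s) = R(−φ) V(R(φ) z, s + 2 log λ)`";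
Chae–Wolf 2017, §4: DSS ⇔ `U(·, s) = U(·, s + 2 log λ)`). For a rotated `c`-DSS field
(`c • R⁻¹ u(c²t, c R x) = u(t, x)`, accepted `IsRotatedDSS`) and `0 < c`:
`U(s + 2 log c, y) = R⁻¹ U(s, R y)`. [cite: BradshawTsai2017CPDE, §1 (V-RDSS)] -/
theorem IsRotatedDSS.lerayOrbit_add_period {c : ℝ} {R : E ≃ₗᵢ[ℝ] E} {u : ℝ → E → E}
    (h : IsRotatedDSS c R u) (hc : 0 < c) (s : ℝ) (y : E) :
    lerayOrbit u (s + 2 * Real.log c) y = R.symm (lerayOrbit u s (R y)) := by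
  have hc' : c ≠ 0 := hc.ne'
  have h1 : Real.exp (-(s + 2 * Real.log c) / 2) = Real.exp (-s / 2) * c⁻¹ := by
    rw [show -(s + 2 * Real.log c) / 2 = -s / 2 + -Real.log c by ring, Real.exp_add]
    congr 1
    rw [Real.exp_neg, Real.exp_log hc]
  have h2 : Real.exp (-(s + 2 * Real.log c)) = Real.exp (-s) * (c ^ 2)⁻¹ := by
    rw [show -(s + 2 * Real.log c) = -s + -(2 * Real.log c) by ring, Real.exp_add]
    congr 1
    rw [Real.exp_neg, show (2 : ℝ) * Real.log c = Real.log c + Real.log c by ring, Real.exp_add,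
      Real.exp_log hc, sq]
  have key := h (-(Real.exp (-s) * (c ^ 2)⁻¹)) ((Real.exp (-s / 2) * c⁻¹) • y)
  have h3 : c ^ 2 * -(Real.exp (-s) * (c ^ 2)⁻¹) = -Real.exp (-s) := by field_simp
  have h4 : c • R ((Real.exp (-s / 2) * c⁻¹) • y) = Real.exp (-s / 2) • R y := by
    rw [R.map_smul, smul_smul]; congr 1; field_simp
  rw [h3, h4] at key
  rw [lerayOrbit_apply, lerayOrbit_apply, h1, h2, ← key, smul_smul, ← R.symm.map_smul]
  congr 1
  rw [show Real.exp (-s / 2) * c⁻¹ * c = Real.exp (-s / 2) by field_simp]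

/-- **Smoothness of the orbit**: if `u` is jointly `C^n` on `(−∞, 0) × E` then `U = lerayOrbit u`
is jointly `C^n` on `ℝ × E` (composition with the smooth map `(s, y) ↦ (−e^{−s}, e^{−s/2} y)`,
which lands in `t < 0`). [folklore] -/
theorem contDiff_uncurry_lerayOrbit {n : WithTop ℕ∞} {u : ℝ → E → F}
    (hu : ContDiffOn ℝ n (uncurry u) (Iio 0 ×ˢ univ)) : ContDiff ℝ n (uncurry (lerayOrbit u)) := by
  have hΦ : ContDiff ℝ n fun p : ℝ × E => (-Real.exp (-p.1), Real.exp (-p.1 / 2) • p.2) :=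
    ((Real.contDiff_exp.comp contDiff_fst.neg).neg).prodMk
      ((Real.contDiff_exp.comp (contDiff_fst.neg.div_const 2)).smul contDiff_snd)
  have hmem : ∀ p : ℝ × E, (-Real.exp (-p.1), Real.exp (-p.1 / 2) • p.2) ∈ Iio (0 : ℝ) ×ˢ (univ : Set E) :=
    fun p => ⟨by simpa using Real.exp_pos (-p.1), mem_univ _⟩
  have hcomp := hu.comp_contDiff hΦ hmem
  have hscal : ContDiff ℝ n fun p : ℝ × E => Real.exp (-p.1 / 2) :=
    Real.contDiff_exp.comp (contDiff_fst.neg.div_const 2)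
  exact hscal.smul hcomp

end Similarity

/-! ### Vorticity of the orbit, the pseudovector action, symmetry modes -/

/-- The **rescaled vorticity** `Ω(s) = curl_y U(s)` of the orbit `U = lerayOrbit u`
(`Ω(y, s) = (−t) ω(x, t)`; the background of the linearised vorticity equation). Inherits the junk
value of `curl` (accepted, `VectorCalculus`) where `U(s)` is not differentiable (excluded by the `smooth` clause below). [folklore] -/
def lerayVorticity (u : ℝ → ℝ³ → ℝ³) (s : ℝ) : ℝ³ → ℝ³ :=
  curl (lerayOrbit u s)

/-- Unfolding `lerayVorticity`. [folklore] -/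
@[simp]
theorem lerayVorticity_apply (u : ℝ → ℝ³ → ℝ³) (s : ℝ) :
    lerayVorticity u s = curl (lerayOrbit u s) :=
  rfl

/-- The **pseudovector action** of a linear isometry `Q ∈ O(3)` on vorticity fields:
`(π̃(Q) ω)(y) = det Q • Q (ω (Q⁻¹ y))` (`det Q = ±1`; for rotations the plain push-forward).
If `V ↦ Q V(Q⁻¹ ·)` is the action on velocities then `curl (Q V(Q⁻¹·)) = π̃(Q) (curl V)`; the
twisted periodicity `U(s + P) = R⁻¹ U(s)(R ·)` of `lerayOrbit_add_period` thus reads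
`Ω(s + P) = π̃(R⁻¹) Ω(s)` on vorticities, and the monodromy is normalised by `π̃(R)`. [folklore] -/
def pseudovectorPush (Q : ℝ³ ≃ₗᵢ[ℝ] ℝ³) (ω : ℝ³ → ℝ³) : ℝ³ → ℝ³ :=
  fun y => LinearMap.det (Q.toLinearEquiv : ℝ³ →ₗ[ℝ] ℝ³) • Q (ω (Q.symm y))

/-- Unfolding `pseudovectorPush`. [folklore] -/
@[simp]
theorem pseudovectorPush_apply (Q : ℝ³ ≃ₗᵢ[ℝ] ℝ³) (ω : ℝ³ → ℝ³) (y : ℝ³) :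
    pseudovectorPush Q ω y = LinearMap.det (Q.toLinearEquiv : ℝ³ →ₗ[ℝ] ℝ³) • Q (ω (Q.symm y)) :=
  rfl

/-- The trivial isometry acts trivially. [folklore] -/
@[simp]
theorem pseudovectorPush_refl (ω : ℝ³ → ℝ³) :
    pseudovectorPush (LinearIsometryEquiv.refl ℝ ℝ³) ω = ω := by
  funext y
  have hdet : LinearMap.det ((LinearIsometryEquiv.refl ℝ ℝ³).toLinearEquiv : ℝ³ →ₗ[ℝ] ℝ³) = 1 := by
    rw [show ((LinearIsometryEquiv.refl ℝ ℝ³).toLinearEquiv : ℝ³ →ₗ[ℝ] ℝ³) = LinearMap.id from rfl,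
      LinearMap.det_id]
  rw [pseudovectorPush_apply, hdet, one_smul]
  rfl

/-- The **orbit tangent** `∂ₛΩ(0, ·)`, the neutral Floquet mode generated by the scaling symmetry
(= `s`-translation of the orbit; multiplier `1`). Two-sided `deriv` in `s` (accepted
`timeDeriv`, `WeakSolution`), honest under the `smooth` clause. [folklore] -/
def orbitTangent (u : ℝ → ℝ³ → ℝ³) : ℝ³ → ℝ³ :=
  timeDeriv (lerayVorticity u) 0

/-- The **infinitesimal rotation mode** of a vorticity slice `Ω₀` along `A ∈ so(3)`:
`Z_A(y) = A Ω₀(y) − DΩ₀(y)[A y] = d/dθ|₀ (e^{θA} Ω₀(e^{−θA} y))` (pseudovector action of the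
rotations `e^{θA}`, `det = 1`). [folklore] -/
def rotationMode (A : ℝ³ →L[ℝ] ℝ³) (Ω₀ : ℝ³ → ℝ³) : ℝ³ → ℝ³ :=
  fun y => A (Ω₀ y) - fderiv ℝ Ω₀ y (A y)

/-- Unfolding `rotationMode`. [folklore] -/
@[simp]
theorem rotationMode_apply (A : ℝ³ →L[ℝ] ℝ³) (Ω₀ : ℝ³ → ℝ³) (y : ℝ³) :
    rotationMode A Ω₀ y = A (Ω₀ y) - fderiv ℝ Ω₀ y (A y) :=
  rfl

/-! ### The weighted solenoidal Hilbert space `X_w` -/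

/-- The **Gaussian weight of the backward similarity variables**, `γ(y) = e^{−|y|²/4}` (`ν = 1`), as
an `ℝ≥0`-valued density: `div (γ ∇ω) = γ (Δ − ½ y·∇) ω`, so `𝓛_ω = Δ − ½ y·∇ − 1` is symmetric with
compact resolvent on `L²(γ dy)` (Hermite spectrum `{−1 − k/2}`); the forward-variables twin is
Gallay–Wayne's `X = L²(G⁻¹ dξ)`, `G = (4π)⁻¹ e^{−|ξ|²/4}`, for `Δ + ½ ξ·∇ + 1` (CMP 255 (2005),
§4.1.3, Lemma 4.7). [cite: GallayWayne2005, §4.1.3 and Lemma 4.7 (forward twin)] -/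
def gaussianWeight (y : ℝ³) : ℝ≥0 :=
  ⟨Real.exp (-‖y‖ ^ 2 / 4), (Real.exp_pos _).le⟩

/-- The Gaussian weight as a real number. [folklore] -/
@[simp]
theorem coe_gaussianWeight (y : ℝ³) : (gaussianWeight y : ℝ) = Real.exp (-‖y‖ ^ 2 / 4) :=
  rfl

/-- The Gaussian weight is positive. [folklore] -/
theorem gaussianWeight_pos (y : ℝ³) : 0 < gaussianWeight y := by
  rw [← NNReal.coe_pos, coe_gaussianWeight]
  exact Real.exp_pos _

/-- The Gaussian weight is at most `1` (so `L²(dy) ⊆ L²(γ dy)`). [folklore] -/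
theorem gaussianWeight_le_one (y : ℝ³) : gaussianWeight y ≤ 1 := by
  rw [← NNReal.coe_le_coe, coe_gaussianWeight, NNReal.coe_one, Real.exp_le_one_iff]
  have := sq_nonneg ‖y‖
  linarith

/-- The Gaussian weight is continuous. [folklore] -/
theorem continuous_gaussianWeight : Continuous gaussianWeight :=
  continuous_induced_rng.2
    (Real.continuous_exp.comp ((continuous_norm.pow 2).neg.div_const 4))

/-- The weighted Lebesgue measure `w(y) dy` on `ℝ³` for an `ℝ≥0`-valued weight (Mathlib
`Measure.withDensity`). [folklore] -/
def weightedMeasure (w : ℝ³ → ℝ≥0) : Measure ℝ³ :=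
  volume.withDensity fun y => (w y : ℝ≥0∞)

/-- For a continuous weight, `w dy` is locally finite (hence finite on compacts). [folklore] -/
theorem isLocallyFiniteMeasure_weightedMeasure {w : ℝ³ → ℝ≥0} (hw : Continuous w) :
    IsLocallyFiniteMeasure (weightedMeasure w) :=
  IsLocallyFiniteMeasure.withDensity_coe hw

/-- The classes in `L²(w dy; ℝ³)` of the fields `w⁻¹ ∇θ`, `θ ∈ C_c^∞(ℝ³)` real: for `w > 0`,
`⟪[w⁻¹∇θ], [ω]⟫_{L²(w dy)} = ∫ ⟪ω, ∇θ⟫ dy` (`inner_toLp_inv_smul_gradient`), the pairing of the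
weak divergence (accepted `IsWeaklyDivFree`, `VectorCalculus`). [folklore] -/
def gradientClasses (w : ℝ³ → ℝ≥0) : Set (Lp ℝ³ 2 (weightedMeasure w)) :=
  {g | ∃ (θ : ℝ³ → ℝ) (_ : FunctionSpaces.IsTestFunctionOn (⊤ : Opens ℝ³) θ)
      (hm : MemLp (fun y => (w y : ℝ)⁻¹ • gradient θ y) 2 (weightedMeasure w)), g = hm.toLp _}

/-- **The weighted solenoidal space** `X_w = L²_σ(w dy) = {ω ∈ L²(ℝ³, w dy; ℝ³) : div ω = 0 weakly}`,
realised as the orthogonal complement of the gradient classes in the Hilbert space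
`Lp ℝ³ 2 (w dy)`; a closed subspace (`Submodule.isClosed_orthogonal`), hence a Hilbert space; for
continuous `w > 0` membership is exactly weak divergence-freeness of the representative
(`mem_divFreeL2_iff_isWeaklyDivFree`). For `w = γ` this is the card's `X = L²_σ(e^{−|y|²/4})` in
vorticity form. [folklore] -/
def divFreeL2 (w : ℝ³ → ℝ≥0) : Submodule ℝ (Lp ℝ³ 2 (weightedMeasure w)) :=
  (Submodule.span ℝ (gradientClasses w))ᗮ

/-- Membership in `X_w`: orthogonality to every gradient class. [folklore] -/
theorem mem_divFreeL2_iff {w : ℝ³ → ℝ≥0} {f : Lp ℝ³ 2 (weightedMeasure w)} :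
    f ∈ divFreeL2 w ↔ ∀ g ∈ gradientClasses w, ⟪g, f⟫ = 0 := by
  refine ⟨fun h g hg => Submodule.inner_right_of_mem_orthogonal (Submodule.subset_span hg) h,
    fun h => ?_⟩
  rw [divFreeL2, Submodule.mem_orthogonal]
  intro g hg
  induction hg using Submodule.span_induction with
  | mem x hx => exact h x hx
  | zero => simp
  | add x y _ _ hx hy => rw [inner_add_left, hx, hy, add_zero]
  | smul a x _ hx => rw [inner_smul_left, hx, mul_zero]

/-- `X_w` is closed. [folklore] -/
theorem isClosed_divFreeL2 (w : ℝ³ → ℝ≥0) : IsClosed (divFreeL2 w : Set (Lp ℝ³ 2 (weightedMeasure w))) :=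
  Submodule.isClosed_orthogonal _

/-- For a continuous positive weight, `w⁻¹ ∇θ ∈ L²(w dy)` for every test function `θ` (continuous
with compact support; `w dy` is finite on compacts). [folklore] -/
theorem memLp_inv_smul_gradient {w : ℝ³ → ℝ≥0} (hw : Continuous w) (hpos : ∀ y, 0 < w y)
    {θ : ℝ³ → ℝ} (hθ : FunctionSpaces.IsTestFunctionOn (⊤ : Opens ℝ³) θ) :
    MemLp (fun y => (w y : ℝ)⁻¹ • gradient θ y) 2 (weightedMeasure w) := by
  haveI := isLocallyFiniteMeasure_weightedMeasure hw
  have hgrad : Continuous (gradient θ) :=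
    (InnerProductSpace.toDual ℝ ℝ³).symm.continuous.comp (hθ.contDiff.continuous_fderiv (by simp))
  have hsupp : HasCompactSupport (gradient θ) :=
    (hθ.hasCompactSupport.fderiv (𝕜 := ℝ)).comp_left (map_zero _)
  have hinv : Continuous fun y => (w y : ℝ)⁻¹ :=
    (NNReal.continuous_coe.comp hw).inv₀ fun y => (NNReal.coe_pos.2 (hpos y)).ne'
  exact (hinv.smul hgrad).memLp_of_hasCompactSupport hsupp.smul_left

/-- **The weighted inner product with a gradient class is the weak-divergence pairing**:
`⟪[w⁻¹∇θ], f⟫_{L²(w dy)} = ∫ ⟪f, ∇θ⟫ dy` for a continuous positive weight. [folklore] -/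
theorem inner_toLp_inv_smul_gradient {w : ℝ³ → ℝ≥0} (hw : Continuous w) (hpos : ∀ y, 0 < w y)
    {θ : ℝ³ → ℝ} (hm : MemLp (fun y => (w y : ℝ)⁻¹ • gradient θ y) 2 (weightedMeasure w))
    (f : Lp ℝ³ 2 (weightedMeasure w)) :
    ⟪hm.toLp _, f⟫ = ∫ y, ⟪(f : ℝ³ → ℝ³) y, gradient θ y⟫ := by
  rw [MeasureTheory.L2.inner_def]
  have hae : (fun y => ⟪(hm.toLp _ : ℝ³ → ℝ³) y, (f : ℝ³ → ℝ³) y⟫) =ᵐ[weightedMeasure w]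
      fun y => ⟪(w y : ℝ)⁻¹ • gradient θ y, (f : ℝ³ → ℝ³) y⟫ :=
    hm.coeFn_toLp.mono fun y hy => by simp only [hy]
  rw [integral_congr_ae hae]
  unfold weightedMeasure
  rw [integral_withDensity_eq_integral_smul hw.measurable]
  refine integral_congr_ae (Eventually.of_forall fun y => ?_)
  have hwy : (w y : ℝ) ≠ 0 := (NNReal.coe_pos.2 (hpos y)).ne'
  simp only [NNReal.smul_def, real_inner_smul_left, smul_eq_mul]
  rw [← mul_assoc, mul_inv_cancel₀ hwy, one_mul, real_inner_comm]

/-- **`X_w` is the space of weakly divergence-free `L²(w dy)` fields**: for a continuous positive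
weight, `f ∈ divFreeL2 w` iff the representative of `f` is weakly divergence free (accepted
`IsWeaklyDivFree`: `∫ ⟪f, ∇θ⟫ dy = 0` for all test `θ`). [folklore] -/
theorem mem_divFreeL2_iff_isWeaklyDivFree {w : ℝ³ → ℝ≥0} (hw : Continuous w) (hpos : ∀ y, 0 < w y)
    (f : Lp ℝ³ 2 (weightedMeasure w)) : f ∈ divFreeL2 w ↔ IsWeaklyDivFree (f : ℝ³ → ℝ³) := by
  rw [mem_divFreeL2_iff]
  constructor
  · intro h θ hθ
    rw [← inner_toLp_inv_smul_gradient hw hpos (memLp_inv_smul_gradient hw hpos hθ) f]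
    exact h _ ⟨θ, hθ, memLp_inv_smul_gradient hw hpos hθ, rfl⟩
  · rintro h g ⟨θ, hθ, hm, rfl⟩
    rw [inner_toLp_inv_smul_gradient hw hpos hm f]
    exact h θ hθ

/-- In particular for the Gaussian space of the card. [folklore] -/
theorem mem_divFreeL2_gaussianWeight_iff (f : Lp ℝ³ 2 (weightedMeasure gaussianWeight)) :
    f ∈ divFreeL2 gaussianWeight ↔ IsWeaklyDivFree (f : ℝ³ → ℝ³) :=
  mem_divFreeL2_iff_isWeaklyDivFree continuous_gaussianWeight gaussianWeight_pos f

/-! ### The linearised vorticity equation in semi-weak form -/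

/-- The cross product is linear in its first argument (accepted `crossCLM`). [folklore] -/
theorem cross_smul_left (c : ℝ) (v w : ℝ³) : cross (c • v) w = c • cross v w := by
  rw [← crossCLM_apply, ← crossCLM_apply, map_smul, FunLike.coe_smul, Pi.smul_apply]

/-- The cross product is linear in its second argument (accepted `crossCLM`). [folklore] -/
theorem cross_smul_right (c : ℝ) (v w : ℝ³) : cross v (c • w) = c • cross v w := by
  rw [← crossCLM_apply, ← crossCLM_apply, map_smul]

/-- The Biot–Savart kernel is linear in the vorticity argument. [folklore] -/
theorem biotSavartKernel_smul (x : ℝ³) (c : ℝ) (h : ℝ³) :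
    biotSavartKernel x (c • h) = c • biotSavartKernel x h := by
  rw [biotSavartKernel, biotSavartKernel, cross_smul_left, smul_comm]

/-- The Biot–Savart law is homogeneous: `BS[c ω] = c BS[ω]` (no integrability needed, Mathlib
`integral_smul`). [folklore] -/
theorem biotSavart_smul (c : ℝ) (ω : ℝ³ → ℝ³) : biotSavart (c • ω) = c • biotSavart ω := by
  funext x
  simp only [biotSavart, Pi.smul_apply, biotSavartKernel_smul]
  exact integral_smul c _

/-- The right-hand side of the **linearised rescaled vorticity equation** paired with a test field
`φ`: for `∂ₛω = (Δ − ½ y·∇ − 1) ω + curl (U × ω) + curl (BS[ω] × Ω)` one has, formally,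
`d/ds ∫ ω·φ = ∫ ⟪ω, Δφ + ½ Dφ[y] + ½ φ⟫ + ∫ ⟪U × ω, curl φ⟫ + ∫ ⟪BS[ω] × Ω, curl φ⟫`
(vorticity equation: Majda–Bertozzi (2.5); Biot–Savart `biotSavart` (accepted, `Vorticity`); linearisation of
`curl (u × ω)` at `(U, Ω)`). Lebesgue (unweighted) pairings. [folklore] -/
def linVorticityPairing (U Ω ω φ : ℝ³ → ℝ³) : ℝ :=
  (∫ y, ⟪ω y, (Δ φ) y + (1 / 2 : ℝ) • fderiv ℝ φ y y + (1 / 2 : ℝ) • φ y⟫) +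
    (∫ y, ⟪cross (U y) (ω y), curl φ y⟫) + ∫ y, ⟪cross (biotSavart ω y) (Ω y), curl φ y⟫

/-- The pairing vanishes for the zero perturbation. [folklore] -/
@[simp]
theorem linVorticityPairing_zero (U Ω φ : ℝ³ → ℝ³) : linVorticityPairing U Ω 0 φ = 0 := by
  simp [linVorticityPairing, cross, biotSavart]

/-- The pairing is homogeneous in the perturbation. [folklore] -/
theorem linVorticityPairing_smul (U Ω : ℝ³ → ℝ³) (c : ℝ) (ω φ : ℝ³ → ℝ³) :
    linVorticityPairing U Ω (c • ω) φ = c * linVorticityPairing U Ω ω φ := by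
  simp only [linVorticityPairing, biotSavart_smul, Pi.smul_apply, cross_smul_left, cross_smul_right,
    real_inner_smul_left, integral_const_mul]
  ring

/-- **Weak solutions of the linearised vorticity equation** about the background `(U, Ω)` on the
`s`-interval `[a, b]`: `ω` is jointly continuous, its slices lie in `L²(dy)` uniformly on `[a, b]`
and are weakly divergence free, the Biot–Savart integrals `BS[ω(s)](x)` converge absolutely to a
locally integrable field, and
for every test field `φ ∈ C_c^∞(ℝ³; ℝ³)` the pairing `s ↦ ∫ ω(s)·φ` is differentiable on `(a, b)`
with derivative `linVorticityPairing (U s) (Ω s) (ω s) φ` (its continuity on `[a, b]` follows from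
the joint continuity). The class on which a monodromy must reproduce the dynamics
(`IsLinearisedMonodromy`); it contains the classical solutions from `C_c^∞` solenoidal data. [folklore] -/
structure IsLinearisedVorticitySolution (U Ω : ℝ → ℝ³ → ℝ³) (a b : ℝ) (ω : ℝ → ℝ³ → ℝ³) : Prop where
  /-- Joint continuity in `(s, y)`. -/
  continuous : Continuous (uncurry ω)
  /-- Slices in `L²(dy)`. -/
  memLp : ∀ s ∈ Icc a b, MemLp (ω s) 2 volume
  /-- Uniformly on `[a, b]`. -/
  eLpNorm_le : ∃ C : ℝ≥0, ∀ s ∈ Icc a b, eLpNorm (ω s) 2 volume ≤ C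
  /-- Slices are weakly divergence free. -/
  isWeaklyDivFree : ∀ s ∈ Icc a b, IsWeaklyDivFree (ω s)
  /-- The Biot–Savart integrals converge absolutely (true for continuous `L²` slices; recorded). -/
  integrable_kernel : ∀ s ∈ Icc a b, ∀ x : ℝ³,
    Integrable (fun y => biotSavartKernel (x - y) (ω s y)) volume
  /-- The Biot–Savart velocities are locally integrable (true for continuous `L²` slices, for which
  they are continuous; recorded so that every pairing in `linVorticityPairing` is an honest integral). -/
  locallyIntegrable_biotSavart : ∀ s ∈ Icc a b, LocallyIntegrable (biotSavart (ω s)) volume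
  /-- The equation, paired with time-independent test fields, on the open interval. -/
  hasDerivAt : ∀ φ : ℝ³ → ℝ³, FunctionSpaces.IsTestFunctionOn (⊤ : Opens ℝ³) φ →
    ∀ s ∈ Ioo a b, HasDerivAt (fun σ => ∫ y, ⟪ω σ y, φ y⟫) (linVorticityPairing (U s) (Ω s) (ω s) φ) s

/-- The zero perturbation solves the linearised equation about any background. [folklore] -/
theorem IsLinearisedVorticitySolution.zero (U Ω : ℝ → ℝ³ → ℝ³) (a b : ℝ) :
    IsLinearisedVorticitySolution U Ω a b 0 where
  continuous := continuous_const
  memLp _ _ := by simp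
  eLpNorm_le := ⟨0, fun s _ => by simp⟩
  isWeaklyDivFree _ _ θ _ := by simp
  integrable_kernel _ _ x := by simp
  locallyIntegrable_biotSavart _ _ := by
    rw [Pi.zero_apply, biotSavart_zero]
    exact locallyIntegrable_const (0 : ℝ³)
  hasDerivAt φ _ s _ := by
    simpa using hasDerivAt_const s (0 : ℝ)

/-- **The solution class is a cone**: scalar multiples of weak solutions are weak solutions (all
clauses are homogeneous; consistent with the linearity of a monodromy). [folklore] -/
theorem IsLinearisedVorticitySolution.smul {U Ω : ℝ → ℝ³ → ℝ³} {a b : ℝ} {ω : ℝ → ℝ³ → ℝ³}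
    (h : IsLinearisedVorticitySolution U Ω a b ω) (c : ℝ) :
    IsLinearisedVorticitySolution U Ω a b (c • ω) := by
  have e : ∀ s, (c • ω) s = c • ω s := fun _ => rfl
  have e' : ∀ s y, (c • ω) s y = c • ω s y := fun _ _ => rfl
  have eu : uncurry (c • ω) = fun p => c • uncurry ω p := rfl
  refine ⟨?_, fun s hs => ?_, ?_, fun s hs θ hθ => ?_, fun s hs x => ?_, fun s hs => ?_,
    fun φ hφ s hs => ?_⟩
  · rw [eu]
    exact h.continuous.const_smul c
  · rw [e]
    exact (h.memLp s hs).const_smul c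
  · obtain ⟨C, hC⟩ := h.eLpNorm_le
    refine ⟨‖c‖₊ * C, fun s hs => ?_⟩
    rw [e]
    calc eLpNorm (c • ω s) 2 volume ≤ ‖c‖ₑ * eLpNorm (ω s) 2 volume := eLpNorm_const_smul_le
      _ ≤ ‖c‖ₑ * C := by gcongr; exact hC s hs
      _ = ((‖c‖₊ * C : ℝ≥0) : ℝ≥0∞) := by rw [ENNReal.coe_mul, enorm_eq_nnnorm]
  · have h0 := h.isWeaklyDivFree s hs θ hθ
    simp only [e', real_inner_smul_left, integral_const_mul, h0, mul_zero]
  · simp only [e', biotSavartKernel_smul]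
    exact (h.integrable_kernel s hs x).smul c
  · rw [e, biotSavart_smul]
    exact (h.locallyIntegrable_biotSavart s hs).smul c
  · have key := (h.hasDerivAt φ hφ s hs).const_mul c
    have e1 : (fun σ => ∫ y, ⟪(c • ω) σ y, φ y⟫) = fun σ => c * ∫ y, ⟪ω σ y, φ y⟫ := by
      funext σ
      simp only [e', real_inner_smul_left, integral_const_mul]
    rw [e1, e, linVorticityPairing_smul]
    exact key

/-- **The pairings are continuous in `s`** (on all of `ℝ`, in particular on `[a, b]`): joint
continuity of `ω` and compact support of the test field (dominated convergence, Mathlib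
`continuous_parametric_integral_of_continuous`). Together with `hasDerivAt` on `(a, b)` this
determines `∫ ω(b)·φ` from `∫ ω(a)·φ`, which is why no endpoint clause is needed. [folklore] -/
theorem IsLinearisedVorticitySolution.continuous_pairing {U Ω : ℝ → ℝ³ → ℝ³} {a b : ℝ}
    {ω : ℝ → ℝ³ → ℝ³} (h : IsLinearisedVorticitySolution U Ω a b ω) {φ : ℝ³ → ℝ³}
    (hφ : FunctionSpaces.IsTestFunctionOn (⊤ : Opens ℝ³) φ) :
    Continuous fun σ => ∫ y, ⟪ω σ y, φ y⟫ := by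
  have heq : (fun σ => ∫ y, ⟪ω σ y, φ y⟫) = fun σ => ∫ y in tsupport φ, ⟪ω σ y, φ y⟫ := by
    funext σ
    refine (setIntegral_eq_integral_of_forall_compl_eq_zero fun y hy => ?_).symm
    rw [image_eq_zero_of_notMem_tsupport hy, inner_zero_right]
  rw [heq]
  exact continuous_parametric_integral_of_continuous (f := fun σ y => ⟪ω σ y, φ y⟫)
    (h.continuous.inner (hφ.contDiff.continuous.comp continuous_snd)) hφ.hasCompactSupport

/-! ### The monodromy as data -/

/-- **Linearised monodromy (interface).** `M` is a bounded operator on `L²(w dy; ℝ³)` which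
(i) maps `X_w` into itself and vanishes on `X_wᗮ` (normalisation: an operator ON `X_w`), and
(ii) **propagates the linearised dynamics over one period** `P = 2 log c`: for every weak solution
`ω` of the vorticity equation linearised at the orbit `(U, Ω) = (lerayOrbit u, lerayVorticity u)`
on `[0, P]` whose initial slice defines an element of `X_w`, `M [ω(0)] = [π̃(R) ω(P)]`
(`pseudovectorPush`; `M = π̃(R) ∘ S(P, 0)`, so that `S(kP, 0) = π̃(R⁻¹)^k M^k`). Existence of such
an `M` is NOT asserted (crux `GaussianFloquetTheory`); Henry 1981, Ch. 7 (period map). [folklore] -/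
structure IsLinearisedMonodromy (w : ℝ³ → ℝ≥0) (c : ℝ) (R : ℝ³ ≃ₗᵢ[ℝ] ℝ³) (u : ℝ → ℝ³ → ℝ³)
    (M : Lp ℝ³ 2 (weightedMeasure w) →L[ℝ] Lp ℝ³ 2 (weightedMeasure w)) : Prop where
  /-- `M` maps the solenoidal space into itself. -/
  mapsTo : ∀ f ∈ divFreeL2 w, M f ∈ divFreeL2 w
  /-- Normalisation: `M` vanishes on the orthogonal complement of the solenoidal space. -/
  eq_zero : ∀ f ∈ (divFreeL2 w)ᗮ, M f = 0
  /-- `M` reproduces every weak solution of the linearised equation over one period, twisted by the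
  pseudovector action of `R`. -/
  propagates : ∀ ω : ℝ → ℝ³ → ℝ³,
    IsLinearisedVorticitySolution (lerayOrbit u) (lerayVorticity u) 0 (2 * Real.log c) ω →
      ∀ (h₀ : MemLp (ω 0) 2 (weightedMeasure w))
        (h₁ : MemLp (pseudovectorPush R (ω (2 * Real.log c))) 2 (weightedMeasure w)),
        h₀.toLp _ ∈ divFreeL2 w → M (h₀.toLp _) = h₁.toLp _

/-! ### Hyperbolicity modulo a neutral subspace -/

section Hyperbolic

variable {𝕜 : Type*} [RCLike 𝕜] {E : Type*} [NormedAddCommGroup E] [NormedSpace 𝕜 E]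

/-- **Hyperbolicity of a bounded operator modulo a prescribed neutral subspace `N`**
(complexification-free rendering of: finitely many spectral values, counted with multiplicity, in
`{|z| ≥ 1}`; those on the unit circle semisimple with total eigenspace exactly `N`; the rest of the
spectrum in `{|z| < 1}`): `N` is finite-dimensional, `M`-invariant, and `M|N` is power-bounded with
power-bounded inverse (⇔ semisimple with unit-modulus eigenvalues); and there are `M`-invariant
subspaces `X_s` (closed) and `X_u` (finite-dimensional) with `E = X_s ⊕ X_u ⊕ N`, `M` exponentially
contracting on `X_s` and exponentially expanding on `X_u`. Equivalent to the spectral statement by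
Riesz projections (Henry 1981, Ch. 7–8: characteristic multipliers of the period map). [cite: Henry1981, Ch. 7–8 (period map, characteristic multipliers)] -/
structure IsHyperbolicWithNeutral (M : E →L[𝕜] E) (N : Submodule 𝕜 E) : Prop where
  /-- The neutral space is finite-dimensional. -/
  finiteDimensional_neutral : FiniteDimensional 𝕜 N
  /-- The neutral space is invariant. -/
  neutral_invariant : ∀ x ∈ N, M x ∈ N
  /-- `M|N` and its inverse are power-bounded (semisimple, spectrum on the unit circle). -/
  neutral_bound : ∃ K : ℝ, ∀ x ∈ N, ∀ n : ℕ, ‖x‖ ≤ K * ‖(M ^ n) x‖ ∧ ‖(M ^ n) x‖ ≤ K * ‖x‖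
  /-- Stable/unstable splitting of a complement of `N`. -/
  exists_splitting : ∃ Xs Xu : Submodule 𝕜 E, IsClosed (Xs : Set E) ∧ FiniteDimensional 𝕜 Xu ∧
    (∀ x ∈ Xs, M x ∈ Xs) ∧ (∀ x ∈ Xu, M x ∈ Xu) ∧
    Xs ⊓ (Xu ⊔ N) = ⊥ ∧ Xu ⊓ N = ⊥ ∧ Xs ⊔ Xu ⊔ N = ⊤ ∧
    ∃ K θ : ℝ, 0 ≤ θ ∧ θ < 1 ∧ (∀ x ∈ Xs, ∀ n : ℕ, ‖(M ^ n) x‖ ≤ K * θ ^ n * ‖x‖) ∧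
      ∀ x ∈ Xu, ∀ n : ℕ, ‖x‖ ≤ K * θ ^ n * ‖(M ^ n) x‖

/-- `‖Mⁿ x‖ ≤ ‖M‖ⁿ ‖x‖`. [folklore] -/
theorem norm_pow_apply_le (M : E →L[𝕜] E) (n : ℕ) (x : E) : ‖(M ^ n) x‖ ≤ ‖M‖ ^ n * ‖x‖ := by
  induction n generalizing x with
  | zero => simp
  | succ n ih =>
    rw [pow_succ, ContinuousLinearMap.mul_def, ContinuousLinearMap.comp_apply, pow_succ]
    calc ‖(M ^ n) (M x)‖ ≤ ‖M‖ ^ n * ‖M x‖ := ih (M x)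
      _ ≤ ‖M‖ ^ n * (‖M‖ * ‖x‖) := by gcongr; exact M.le_opNorm x
      _ = ‖M‖ ^ n * ‖M‖ * ‖x‖ := by ring

/-- A strict contraction is hyperbolic with no neutral and no unstable directions
(`X_s = E`, `θ = ‖M‖`). [folklore] -/
theorem IsHyperbolicWithNeutral.of_opNorm_lt_one {M : E →L[𝕜] E} (hM : ‖M‖ < 1) :
    IsHyperbolicWithNeutral M ⊥ where
  finiteDimensional_neutral := inferInstance
  neutral_invariant x hx := by
    rw [Submodule.mem_bot] at hx
    simp [hx]
  neutral_bound := ⟨1, fun x hx n => by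
    rw [Submodule.mem_bot] at hx
    simp [hx]⟩
  exists_splitting := by
    refine ⟨⊤, ⊥, ?_, inferInstance, fun _ _ => trivial, fun x hx => ?_, by simp, by simp, by simp,
      1, ‖M‖, norm_nonneg _, hM, fun x _ n => ?_, fun x hx n => ?_⟩
    · simp
    · rw [Submodule.mem_bot] at hx; simp [hx]
    · rw [one_mul]
      exact norm_pow_apply_le M n x
    · rw [Submodule.mem_bot] at hx; simp [hx]

end Hyperbolic

/-! ### Hyperbolic Type-I DSS orbits -/

/-- The **symmetry (neutral) modes** at the base point `s = 0` as classes in `L²(w dy)`: the orbit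
tangent `∂ₛΩ(0)` and the rotation modes `Z_A = AΩ(0) − DΩ(0)[A·]`, `A ∈ so(3)`
(`skewAdjoint (ℝ³ →L[ℝ] ℝ³)`). Classes are formed from membership proofs; the structure below
requires these memberships, so that no mode is silently dropped. [folklore] -/
def neutralModes (w : ℝ³ → ℝ≥0) (u : ℝ → ℝ³ → ℝ³) : Set (Lp ℝ³ 2 (weightedMeasure w)) :=
  {g | ∃ hm : MemLp (orbitTangent u) 2 (weightedMeasure w), g = hm.toLp _} ∪
    {g | ∃ A ∈ skewAdjoint (ℝ³ →L[ℝ] ℝ³),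
      ∃ hm : MemLp (rotationMode A (lerayVorticity u 0)) 2 (weightedMeasure w), g = hm.toLp _}

/-- **Type-I rotated-DSS ancient profile** (the object of Bradshaw–Tsai 2017, §5, Open Problem 5.1,
with a smooth representative): clause (a) of `IsHyperbolicTypeIDSSOrbitW`. The field
`u : ℝ → ℝ³ → ℝ³` (`ν = 1`) is an ancient mild solution on `(−∞, 0) × ℝ³` with measurable slices,
rotated `c`-DSS for the isometry `R` (`c R⁻¹ u(c²t, cRx) = u(t,x)`, `1 < c`), obeys a Type I bound
`|u| ≤ C₀/(|x| + √(−t))`, is NOT a.e. zero on the slices `t < 0` — i.e. it is a counterexample to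
`RotatedTypeIDSSLiouville c R` (`IsTypeIDSSProfile.not_rotatedTypeIDSSLiouville`) — and is jointly
smooth on `t < 0` (regularity of the representative; automatic for the continuous representative
by Koch–Nadirashvili–Seregin–Šverák 2009, §2–4). Its similarity orbit `U = lerayOrbit u` is
`2 log c`-periodic modulo `R` (`IsTypeIDSSProfile.lerayOrbit_add_period`) with vorticity
`Ω = lerayVorticity u`: the hypothesis of crux `GaussianFloquetTheory`. [cite: BradshawTsai2017CPDE, §5 Open Problem 5.1] -/
structure IsTypeIDSSProfile (c : ℝ) (R : ℝ³ ≃ₗᵢ[ℝ] ℝ³) (u : ℝ → ℝ³ → ℝ³) : Prop where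
  /-- The scaling factor exceeds `1`. -/
  one_lt : 1 < c
  /-- `u` is an ancient mild solution with `ν = 1` (accepted `IsAncientMildSolution`). -/
  isAncientMildSolution : IsAncientMildSolution 1 u
  /-- Measurable slices (the `L^∞_loc` class of the Liouville statements). -/
  aestronglyMeasurable : ∀ t < 0, AEStronglyMeasurable (u t) volume
  /-- Rotated discrete self-similarity (accepted `IsRotatedDSS`). -/
  isRotatedDSS : IsRotatedDSS c R u
  /-- Type I space–time decay (accepted `HasTypeIDecay`). -/
  hasTypeIDecay : ∃ C₀ : ℝ, HasTypeIDecay C₀ u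
  /-- Non-triviality: not a.e. zero on every slice `t < 0`. -/
  nontrivial : ¬ ∀ t < 0, u t =ᵐ[volume] 0
  /-- Regularity of the representative: jointly smooth on `(−∞, 0) × ℝ³`. -/
  smooth : ContDiffOn ℝ (⊤ : ℕ∞) (uncurry u) (Iio 0 ×ˢ univ)

namespace IsTypeIDSSProfile

variable {c : ℝ} {R : ℝ³ ≃ₗᵢ[ℝ] ℝ³} {u : ℝ → ℝ³ → ℝ³}

/-- A Type-I DSS profile is a counterexample to the rotated Type-I DSS Liouville statement
`RotatedTypeIDSSLiouville c R` (Bradshaw–Tsai 2017, §5, Open Problem 5.1). [cite: BradshawTsai2017CPDE, §5 Open Problem 5.1] -/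
theorem not_rotatedTypeIDSSLiouville (h : IsTypeIDSSProfile c R u) : ¬ RotatedTypeIDSSLiouville c R :=
  fun hL => h.nontrivial (hL h.one_lt u h.isAncientMildSolution h.aestronglyMeasurable
    h.isRotatedDSS h.hasTypeIDecay)

/-- Hence it refutes the wall `TypeIDSSLiouvilleConjecture` ((H1) of the route). [folklore] -/
theorem not_typeIDSSLiouvilleConjecture (h : IsTypeIDSSProfile c R u) : ¬ TypeIDSSLiouvilleConjecture :=
  fun hL => h.not_rotatedTypeIDSSLiouville ((hL c).2 R)

/-- The orbit is jointly smooth on `ℝ × ℝ³`. [folklore] -/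
theorem contDiff_lerayOrbit (h : IsTypeIDSSProfile c R u) : ContDiff ℝ (⊤ : ℕ∞) (uncurry (lerayOrbit u)) :=
  contDiff_uncurry_lerayOrbit h.smooth

/-- The orbit is `2 log c`-periodic modulo `R`. [cite: BradshawTsai2017CPDE, §1 (V-RDSS)] -/
theorem lerayOrbit_add_period (h : IsTypeIDSSProfile c R u) (s : ℝ) (y : ℝ³) :
    lerayOrbit u (s + 2 * Real.log c) y = R.symm (lerayOrbit u s (R y)) :=
  h.isRotatedDSS.lerayOrbit_add_period (by linarith [h.one_lt]) s y

/-- The orbit is bounded with Type I decay in `y`, uniformly in `s`. [cite: BradshawTsai2017CPDE, §5 Open Problem 5.1] -/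
theorem exists_norm_lerayOrbit_le (h : IsTypeIDSSProfile c R u) :
    ∃ C₀ : ℝ, ∀ s y, ‖lerayOrbit u s y‖ ≤ C₀ / (‖y‖ + 1) := by
  obtain ⟨C₀, hC⟩ := h.hasTypeIDecay
  exact ⟨C₀, fun s y => hC.norm_lerayOrbit_le s y⟩

/-- The period is positive. [folklore] -/
theorem period_pos (h : IsTypeIDSSProfile c R u) : 0 < 2 * Real.log c :=
  mul_pos two_pos (Real.log_pos h.one_lt)

end IsTypeIDSSProfile

/-- **Compact linearised monodromy** in `X_w`: some compact operator on `L²(w dy; ℝ³)` is a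
linearised monodromy of the orbit of `u` (`IsLinearisedMonodromy`). The conclusion shape of crux
`GaussianFloquetTheory` ("the one-period operator is COMPACT"), for `w = gaussianWeight`; nothing
here asserts it. [folklore] -/
def HasCompactLinearisedMonodromy (w : ℝ³ → ℝ≥0) (c : ℝ) (R : ℝ³ ≃ₗᵢ[ℝ] ℝ³)
    (u : ℝ → ℝ³ → ℝ³) : Prop :=
  ∃ M : Lp ℝ³ 2 (weightedMeasure w) →L[ℝ] Lp ℝ³ 2 (weightedMeasure w),
    IsLinearisedMonodromy w c R u M ∧ IsCompactOperator M

/-- **Hyperbolic Type-I rotated-DSS orbit in the weighted solenoidal space `X_w`** (idea card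
`dss-far-field-slaving`, (H1) ∧ (H2), with the vorticity space `L²_σ(w dy)`): `u` is a Type-I
rotated-DSS ancient profile (`IsTypeIDSSProfile`: clause (a), a counterexample to
`RotatedTypeIDSSLiouville c R` with a smooth representative; its orbit `U = lerayOrbit u` is
`2 log c`-periodic modulo `R`, clause (b)), and, clause (c) HYPERBOLICITY: there is a COMPACT
operator `M` on `L²(w dy; ℝ³)` which is a linearised monodromy of the orbit (`IsLinearisedMonodromy`:
lives on `X_w`, reproduces every weak solution of `∂ₛω = (Δ − ½y·∇ − 1)ω + curl(U × ω + BS[ω] × Ω)`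
over one period, twisted by `π̃(R)`), the symmetry modes `∂ₛΩ(0)`, `Z_A` (`A ∈ so(3)`) lie in
`L²(w dy)`, and `M` is hyperbolic modulo their span (`IsHyperbolicWithNeutral`: finitely many
multipliers in `|z| ≥ 1`, the neutral ones semisimple and exactly the symmetry modes, the rest of
the spectrum in `|z| < 1`). Forward analogue of (c): Jia–Šverák 2015, §1–2 (spectral assumptions
(A)/(B) for `𝓛_σ`); framework: Henry 1981, Ch. 7–8. [folklore] -/
structure IsHyperbolicTypeIDSSOrbitW (w : ℝ³ → ℝ≥0) (c : ℝ) (R : ℝ³ ≃ₗᵢ[ℝ] ℝ³)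
    (u : ℝ → ℝ³ → ℝ³) : Prop extends IsTypeIDSSProfile c R u where
  /-- (c): a compact linearised monodromy, hyperbolic modulo the symmetry modes. -/
  hyperbolic : ∃ M : Lp ℝ³ 2 (weightedMeasure w) →L[ℝ] Lp ℝ³ 2 (weightedMeasure w),
    IsLinearisedMonodromy w c R u M ∧ IsCompactOperator M ∧
      MemLp (orbitTangent u) 2 (weightedMeasure w) ∧
      (∀ A ∈ skewAdjoint (ℝ³ →L[ℝ] ℝ³),
        MemLp (rotationMode A (lerayVorticity u 0)) 2 (weightedMeasure w)) ∧
      IsHyperbolicWithNeutral M (Submodule.span ℝ (neutralModes w u))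

/-- **Hyperbolic Type-I rotated-DSS orbit** (the requested notion): `IsHyperbolicTypeIDSSOrbitW`
in the Gaussian solenoidal space `X = L²_σ(e^{−|y|²/4} dy)` of the card `dss-far-field-slaving`
(weight `gaussianWeight`; see the module docstring for the convention and for what is not
asserted). [folklore] -/
def IsHyperbolicTypeIDSSOrbit (c : ℝ) (R : ℝ³ ≃ₗᵢ[ℝ] ℝ³) (u : ℝ → ℝ³ → ℝ³) : Prop :=
  IsHyperbolicTypeIDSSOrbitW gaussianWeight c R u

/-- Unfolding the requested notion. [folklore] -/
theorem isHyperbolicTypeIDSSOrbit_iff (c : ℝ) (R : ℝ³ ≃ₗᵢ[ℝ] ℝ³) (u : ℝ → ℝ³ → ℝ³) :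
    IsHyperbolicTypeIDSSOrbit c R u ↔ IsHyperbolicTypeIDSSOrbitW gaussianWeight c R u :=
  Iff.rfl

namespace IsHyperbolicTypeIDSSOrbitW

variable {w : ℝ³ → ℝ≥0} {c : ℝ} {R : ℝ³ ≃ₗᵢ[ℝ] ℝ³} {u : ℝ → ℝ³ → ℝ³}

/-- A hyperbolic orbit has a compact linearised monodromy (projection of clause (c)). [folklore] -/
theorem hasCompactLinearisedMonodromy (h : IsHyperbolicTypeIDSSOrbitW w c R u) :
    HasCompactLinearisedMonodromy w c R u := by
  obtain ⟨M, hM, hK, -, -, -⟩ := h.hyperbolic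
  exact ⟨M, hM, hK⟩

/-- Clause (a) is a counterexample to `RotatedTypeIDSSLiouville c R`
(Bradshaw–Tsai 2017, §5, Open Problem 5.1). [cite: BradshawTsai2017CPDE, §5 Open Problem 5.1] -/
theorem not_rotatedTypeIDSSLiouville (h : IsHyperbolicTypeIDSSOrbitW w c R u) :
    ¬ RotatedTypeIDSSLiouville c R :=
  h.toIsTypeIDSSProfile.not_rotatedTypeIDSSLiouville

/-- Hence the existence of a hyperbolic orbit refutes the wall `TypeIDSSLiouvilleConjecture`
((H1) of the route is contained in (H1) ∧ (H2)). [folklore] -/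
theorem not_typeIDSSLiouvilleConjecture (h : IsHyperbolicTypeIDSSOrbitW w c R u) :
    ¬ TypeIDSSLiouvilleConjecture :=
  h.toIsTypeIDSSProfile.not_typeIDSSLiouvilleConjecture

end IsHyperbolicTypeIDSSOrbitW

/-- Existence of a hyperbolic orbit in the requested (Gaussian) sense refutes the wall (the shape of
the hypothesis of crux `HyperbolicDssBridge`). [folklore] -/
theorem not_typeIDSSLiouvilleConjecture_of_exists_hyperbolic
    (h : ∃ (c : ℝ) (R : ℝ³ ≃ₗᵢ[ℝ] ℝ³) (u : ℝ → ℝ³ → ℝ³), IsHyperbolicTypeIDSSOrbit c R u) :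
    ¬ TypeIDSSLiouvilleConjecture := by
  obtain ⟨c, R, u, hu⟩ := h
  exact IsHyperbolicTypeIDSSOrbitW.not_typeIDSSLiouvilleConjecture hu

end Literature.Analysis.FluidPDE

end
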